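import Summits.ResolutionOfSingularities.ResolutionOfSingularities.Theorems.EquisingularLiftEquisingularLiftNatCentreCodimTwo
import Summits.ResolutionOfSingularities.ResolutionOfSingularities.Theorems.EquisingularLiftEquisingularLiftNatCentreRegularImmersion
import Literature.AlgebraicGeometry.Resolution.BlowupChartMembership
import Literature.AlgebraicGeometry.Resolution.MarkedIdealsArithmetic
import Literature.AlgebraicGeometry.Resolution.AlterationsBoundaryDivisor
import Literature.AlgebraicGeometry.Resolution.KollarBlowupSequenceFunctors
import HarnessLib

/-!
# [OURS · L1 W4.5(b) · EL♮(3)] T-DIM-CENTRE, Cartier pairs — `hCframe` for a centre `𝒜 ⊔ ℬ` cut by two successive Cartier divisors,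
# with NO dimension datum (the cone round's (k-vi), the curve step's (viii))
# (crux `EquisingularLiftNatThree` stmt-ResolutionOfSingularities-20148 / parent EL♮ stmt-…-20038; S1/S2 input (c))

NOT a statement of any manuscript. Helper file of the chain res-L1-w45b (cell `res-hironaka`, slot W4.5(b)); OURS; AI-written, weaker than
expert review; `--supports stmt-ResolutionOfSingularities-20148 --as helper` by res-L1-w45b-stub-3 g7. No `sorry`; standard axioms; no definitions.

WHY. res-D-pv-029's assembly stand-in `hFrame` (S1′) asks for quasi-regular 2-frames of the centres `𝓢 ⊔ K` (curve step) and `𝓔 ⊔ 𝒦` (cone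
round) at ALL their points. Those centres are CARTIER PAIRS: `𝓢` / `𝓔` is an effective Cartier divisor of the (integral) stage and the cone
cuts an effective Cartier divisor on it — clause (k-vi) `IsEffectiveCartier (𝒦.comap 𝓔.subschemeι)` of `Tower.Shadow₂` (…NatTowerInvDefs),
resp. (viii) `IsEffectiveCartier (𝓢.comap K.subschemeι)` of `TCPlus.MemberKC` with the roles swapped. For such a pair the local generators
`(e, κ)` ARE a weakly regular sequence generating `(𝒜 ⊔ ℬ)_x` — res-L1-w45b-stub-2's remark in …NatTowerRuledRoots («two local generators
`(σ̃, κ)` forming a weakly regular sequence suffice») — so `hFrame` needs no dimension datum at all there.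

WHAT (namespace `…Cruxes.EquisingularLiftNat.Sections`).
* **`exists_twoFrame_of_isEffectiveCartier_pair`** — `𝒜` effective Cartier on `X`, `ℬ|_{V(𝒜)}` effective Cartier on `V(𝒜)`, `x ∈ supp (𝒜 ⊔ ℬ)`:
  a pair `c = (e, κ)` with `(c) = (𝒜 ⊔ ℬ)_x`, weakly regular (Mathlib `IsWeaklyRegular`) and quasi-regular (Rees).
* **`forall_exists_twoFrame_of_isEffectiveCartier_pair`** / **`…_pair'`** — `hFrame`/`hCframe` VERBATIM for `𝒜 ⊔ ℬ` and for `ℬ ⊔ 𝒜`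
  (curve step: `𝒜 := K`, `ℬ := 𝓢`, (viii); cone round: `𝒜 := 𝓔`, `ℬ := 𝒦`, (k-vi)).
* **`forall_codim_two_of_isEffectiveCartier_pair`** — on a locally Noetherian `X`, the codimension clause `dim (𝒪_{X,x} ⧸ (𝒜 ⊔ ℬ)_x) + 2 = dim 𝒪_{X,x}`
  on `supp (𝒜 ⊔ ℬ)` (Mathlib `ringKrullDim_add_length_eq_ringKrullDim_of_isRegular`).
* **`isEffectiveCartier_of_isPrincipal_stalkIdeal_of_ne_bot`** — the tower's currency «`∀ z, (stalkIdeal 𝒜 z).IsPrincipal`» + `𝒜 ≠ ⊥` on an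
  integral locally Noetherian `X` ⇒ `IsEffectiveCartier 𝒜` (tree `isEffectiveCartier_of_stalkIdeal_eq_span_singleton`, `stalkIdeal_ne_bot_of_ne_bot`).

References: [cite: Matsumura1987, Thm. 16.2]; [cite: GortzWedhorn2020, (13.19) p. 413]; [cite: StacksProject, Tag 01WS]. Tree: …NatCentreCodimTwo
(this seat), res-D-brk-4 …NatCentreRegularImmersion (`isWeaklyRegular_pair_of_colon`), Literature `IsEffectiveCartier.exists_stalkIdeal_eq_span`,
`stalkIdeal_sup`, `stalkIdeal_comap_eq_map_stalkMap`.
-/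

set_option linter.dupNamespace false -- mandated namespace `Summit.<Summit>.<Problem>` of this single-conjunct summit

noncomputable section

open CategoryTheory CategoryTheory.Limits AlgebraicGeometry TopologicalSpace Topology IsLocalRing
open Literature.AlgebraicGeometry.Resolution
open AlgebraicGeometry.Scheme.IdealSheafData

namespace Summit.ResolutionOfSingularities.ResolutionOfSingularities.Cruxes.EquisingularLiftNat.Sections

universe u

/-- **Local generators of a Cartier pair form a weakly regular 2-frame.** Let `𝒜` be an effective Cartier divisor on `X` and `ℬ` an ideal
sheaf whose restriction `ℬ|_{V(𝒜)}` is an effective Cartier divisor on `V(𝒜)`. At `x ∈ supp (𝒜 ⊔ ℬ)`, with `𝒜_x = (e)` (`e` a nonzerodivisor)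
and `κ ∈ 𝒪_{X,x}` mapping to a nonzerodivisor generator of `(ℬ·𝒪_{V(𝒜)})_x`: `(𝒜 ⊔ ℬ)_x = (e, κ)`, and `(e, κ)` is weakly regular, hence
quasi-regular (Rees). [cite: Matsumura1987, Thm. 16.2] [cite: GortzWedhorn2020, (13.19) p. 413] -/
theorem exists_twoFrame_of_isEffectiveCartier_pair {X : Scheme.{u}} (𝒜 ℬ : X.IdealSheafData) (h𝒜 : IsEffectiveCartier 𝒜)
    (hℬ𝒜 : IsEffectiveCartier (ℬ.comap 𝒜.subschemeι)) {x : X} (hx : x ∈ (𝒜 ⊔ ℬ).support) :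
    ∃ c : Fin 2 → X.presheaf.stalk x, Ideal.span (Set.range c) = stalkIdeal (𝒜 ⊔ ℬ) x ∧
      RingTheory.Sequence.IsWeaklyRegular (X.presheaf.stalk x) (List.ofFn c) ∧ IsQuasiRegular c := by
  -- `x = ι s` for a point `s` of `V(𝒜)`
  have hx𝒜 : x ∈ 𝒜.support :=
    (mem_support_iff_stalkIdeal_le 𝒜 x).mpr
      ((stalkIdeal_mono (le_sup_left : 𝒜 ≤ 𝒜 ⊔ ℬ) x).trans ((mem_support_iff_stalkIdeal_le _ x).mp hx))
  have hx' : x ∈ Set.range 𝒜.subschemeι := by rw [Scheme.IdealSheafData.range_subschemeι]; exact hx𝒜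
  obtain ⟨s, rfl⟩ := hx'
  set R := X.presheaf.stalk (𝒜.subschemeι s) with hR
  set φ := (𝒜.subschemeι.stalkMap s).hom with hφ
  have hsurj : Function.Surjective φ := 𝒜.subschemeι.stalkMap_surjective s
  -- the two generators
  obtain ⟨e, he, h𝒜x⟩ := h𝒜.exists_stalkIdeal_eq_span (𝒜.subschemeι s)
  obtain ⟨κ', hκ', hℬs⟩ := hℬ𝒜.exists_stalkIdeal_eq_span s
  obtain ⟨κ, rfl⟩ := hsurj κ'
  have hker : RingHom.ker φ = Ideal.span {e} := by rw [hφ, ker_stalkMap_subschemeι_eq_stalkIdeal, h𝒜x]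
  -- `(𝒜 ⊔ ℬ)_x = (e) + (κ)`
  have hsup : stalkIdeal (𝒜 ⊔ ℬ) (𝒜.subschemeι s) = Ideal.span {e} ⊔ Ideal.span {κ} := by
    rw [stalkIdeal_sup, h𝒜x]
    have h1 : (stalkIdeal ℬ (𝒜.subschemeι s)).map φ = (Ideal.span {κ}).map φ := by
      rw [hφ, ← stalkIdeal_comap_eq_map_stalkMap, hℬs, Ideal.map_span, Set.image_singleton]
    have h2 := congrArg (Ideal.comap φ) h1
    rw [Ideal.comap_map_of_surjective _ hsurj, Ideal.comap_map_of_surjective _ hsurj, ← RingHom.ker_eq_comap_bot, hker] at h2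
    rw [sup_comm, h2, sup_comm]
  -- the pair `(e, κ)` is weakly regular: `e` is a nonzerodivisor, `κ` is one modulo `e`
  have hreg : RingTheory.Sequence.IsWeaklyRegular R [e, κ] := by
    refine isWeaklyRegular_pair_of_colon e κ (fun y hy => ?_) (fun y hy => ?_)
    · exact (mem_nonZeroDivisors_iff.mp he).1 y hy
    · -- `κ y ∈ (e) = ker φ` ⇒ `φ κ · φ y = 0` ⇒ `φ y = 0` ⇒ `y ∈ ker φ = (e)`
      rw [← hker, RingHom.mem_ker, map_mul] at hy
      rw [← hker, RingHom.mem_ker]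
      exact (mem_nonZeroDivisors_iff.mp hκ').1 (φ y) hy
  refine ⟨![e, κ], ?_, ?_, ?_⟩
  · rw [Matrix.range_cons_cons_empty, hsup, Ideal.span_insert]
  · simpa using hreg
  · exact isQuasiRegular_of_isWeaklyRegular ![e, κ] (by simpa using hreg)

/-- **`hFrame` / `hCframe` for a Cartier pair, verbatim**: `𝒜` effective Cartier on `X`, `ℬ|_{V(𝒜)}` effective Cartier on `V(𝒜)` ⇒ every point of
`supp (𝒜 ⊔ ℬ)` carries a quasi-regular 2-frame of `𝒜 ⊔ ℬ` (cone round: `𝒜 := 𝓔`, `ℬ := 𝒦`, hypothesis (k-vi) of `Tower.Shadow₂`).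
[cite: Matsumura1987, Thm. 16.2] [OURS · L1 W4.5b] toward `stub_elnat_coneTowerPointResolution` (stmt-ResolutionOfSingularities-20148); NOT a
statement of the manuscript. -/
theorem forall_exists_twoFrame_of_isEffectiveCartier_pair {X : Scheme.{u}} (𝒜 ℬ : X.IdealSheafData) (h𝒜 : IsEffectiveCartier 𝒜)
    (hℬ𝒜 : IsEffectiveCartier (ℬ.comap 𝒜.subschemeι)) :
    ∀ x ∈ (𝒜 ⊔ ℬ).support, ∃ c : Fin 2 → X.presheaf.stalk x,
      Ideal.span (Set.range c) = stalkIdeal (𝒜 ⊔ ℬ) x ∧ IsQuasiRegular c := fun x hx => by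
  obtain ⟨c, hc, -, hq⟩ := exists_twoFrame_of_isEffectiveCartier_pair 𝒜 ℬ h𝒜 hℬ𝒜 hx
  exact ⟨c, hc, hq⟩

/-- The same with the summands in the other order (curve step: centre `𝓢 ⊔ K` with `K` effective Cartier and (viii)
`IsEffectiveCartier (𝓢.comap K.subschemeι)`: take `𝒜 := K`, `ℬ := 𝓢`). [cite: Matsumura1987, Thm. 16.2] [OURS · L1 W4.5b]; NOT a statement of
the manuscript. -/
theorem forall_exists_twoFrame_of_isEffectiveCartier_pair' {X : Scheme.{u}} (𝒜 ℬ : X.IdealSheafData) (h𝒜 : IsEffectiveCartier 𝒜)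
    (hℬ𝒜 : IsEffectiveCartier (ℬ.comap 𝒜.subschemeι)) :
    ∀ x ∈ (ℬ ⊔ 𝒜).support, ∃ c : Fin 2 → X.presheaf.stalk x,
      Ideal.span (Set.range c) = stalkIdeal (ℬ ⊔ 𝒜) x ∧ IsQuasiRegular c := by
  rw [sup_comm]
  exact forall_exists_twoFrame_of_isEffectiveCartier_pair 𝒜 ℬ h𝒜 hℬ𝒜

/-- **A Cartier pair has codimension `2` at every point of its support** (on a locally Noetherian `X`): `dim (𝒪_{X,x} ⧸ (𝒜 ⊔ ℬ)_x) + 2 = dim 𝒪_{X,x}`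
— the `hcodim` clause of T-CENTRE-2FRAME for such centres (the weakly regular pair is a regular sequence in the maximal ideal).
[cite: Matsumura1987, Thm. 16.2, Thm. 17.4] [OURS · L1 W4.5b]; NOT a statement of the manuscript. -/
theorem forall_codim_two_of_isEffectiveCartier_pair {X : Scheme.{u}} [IsLocallyNoetherian X] (𝒜 ℬ : X.IdealSheafData)
    (h𝒜 : IsEffectiveCartier 𝒜) (hℬ𝒜 : IsEffectiveCartier (ℬ.comap 𝒜.subschemeι)) :
    ∀ x ∈ (𝒜 ⊔ ℬ).support, ringKrullDim (X.presheaf.stalk x ⧸ stalkIdeal (𝒜 ⊔ ℬ) x) + 2 = ringKrullDim (X.presheaf.stalk x) := by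
  intro x hx
  obtain ⟨c, hc, hreg, -⟩ := exists_twoFrame_of_isEffectiveCartier_pair 𝒜 ℬ h𝒜 hℬ𝒜 hx
  have hle : stalkIdeal (𝒜 ⊔ ℬ) x ≤ maximalIdeal _ := (mem_support_iff_stalkIdeal_le _ x).mp hx
  have hmem : ∀ r ∈ List.ofFn c, r ∈ maximalIdeal (X.presheaf.stalk x) := by
    intro r hr
    obtain ⟨i, rfl⟩ := List.mem_ofFn.mp hr
    exact hle (hc ▸ Ideal.subset_span ⟨i, rfl⟩)
  have hofList : Ideal.ofList (List.ofFn c) = Ideal.span (Set.range c) := by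
    rw [Ideal.ofList]
    congr 1
    ext r
    simp only [Set.mem_setOf_eq, List.mem_ofFn, Set.mem_range]
  have h := ringKrullDim_add_length_eq_ringKrullDim_of_isRegular (List.ofFn c)
    (RingTheory.Sequence.IsRegular.of_isWeaklyRegular_of_mem_maximalIdeal (mem := hmem) (reg := hreg))
  rw [List.length_ofFn, hofList, hc] at h
  exact_mod_cast h

/-- **The tower's currency ⇒ effective Cartier**: on an integral locally Noetherian scheme, an ideal sheaf with principal stalks which is not
`⊥` is an effective Cartier divisor (`Tower.Exc₂`'s `𝓔`, `Tower.Shadow₂`'s `𝒦`, `TCPlus.MemberKC`'s `𝓢`, `K`).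
[cite: StacksProject, Tag 01WS] [OURS · L1 W4.5b]; NOT a statement of the manuscript. -/
theorem isEffectiveCartier_of_isPrincipal_stalkIdeal_of_ne_bot {X : Scheme.{u}} [IsIntegral X] [IsLocallyNoetherian X]
    {𝒜 : X.IdealSheafData} (h𝒜p : ∀ z : X, (stalkIdeal 𝒜 z).IsPrincipal) (h𝒜0 : 𝒜 ≠ ⊥) : IsEffectiveCartier 𝒜 := by
  refine isEffectiveCartier_of_stalkIdeal_eq_span_singleton fun x _ => ?_
  obtain ⟨g, hg⟩ := h𝒜p x
  refine ⟨g, fun h0 => stalkIdeal_ne_bot_of_ne_bot h𝒜0 x ?_, hg⟩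
  rw [hg, h0]
  exact Ideal.span_singleton_eq_bot.mpr rfl

end Summit.ResolutionOfSingularities.ResolutionOfSingularities.Cruxes.EquisingularLiftNat.Sections

end
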